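import Mathlib.MeasureTheory.Measure.Lebesgue.Basic
import Mathlib.MeasureTheory.Integral.Lebesgue.Basic
import Literature.Geometry.Lorentzian.CoordCurvature
import Literature.Geometry.Lorentzian.ExteriorTailHolderSpaces
import HarnessLib

/-!
# ADM coefficient tuples on exterior tails and the classes `𝒞𝒮_{-τ}`, `𝒞𝒮♯_{-τ}`
(Ellithy 2026, arXiv:2605.18730, §3.1, Definitions 3.6, 3.8)

A. Ellithy, *The spacetime Penrose inequality under a quasi final state hypothesis* (2026), §3.1,
p. 21: "We write the metric in the fully general ADM form
`g = -(N² - |β|²_{g(t)}) dt² + 2 β ⊙ dt + g(t)`, `g(t) := (λ² + |b|²_γ) dr² + 2 b ⊙ dr + γ`,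
where `N` and `λ` are functions on `ℳ`, `β` is a `1`-form on `ℳ` with no `dt`-component, `b` is a
`1`-form on `ℳ` tangent to the spacetime spheres `S_{t,r} := {t} × {r} × S²`, and `γ = γ(t,r)` is a
two-parameter family of metrics on `S²` … `λ = |∇^{g(t)} r|⁻¹` … `n_t := λ⁻¹(∂_r - b^{♯_γ})` … is
the outward unit normal to `S_{t,r} ⊂ (M_t, g(t))`. Let `H_{t,r}` denote the mean curvature of
`S_{t,r} ⊂ (M_t, g(t))`, equivalently `H_{t,r} = (2λ)⁻¹ tr_{γ(t,r)}(∂_r γ(t,r) - 𝓛_{b^{♯γ}} γ(t,r))`,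
and let `K_t` denote the second fundamental form of `M_t ↪ (ℳ, g)`. The geometric normal
component of the shift is `β^⊥ := β(n_t)`. … the background forcing
`Ξ(t,r,p) := (λ/N) · tr_{S_{t,r}} K_t / H_{t,r}` … whenever this quantity is finite … the
tail-size functions `𝔛₀(r,T) := r sup_{t ≥ T, p ∈ S²} |Ξ(t,r,p)|`,
`𝔛₁(r,T) := r sup |d̸_γ Ξ|_{γ(t,r)}`, `𝔛₂(r,T) := r² sup |∇̸²_γ Ξ|_{γ(t,r)}` … `sup_{t ≥ T}` is
understood as `sup_{t ≥ max{T, T̲}}`."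

* `ADMTailTuple` — the raw tuple `𝒮 = (N, λ, β = β_r dr + β^T, b, γ)` as functions of `(t, r, p)`,
  sphere-tangent tensors in the ambient rendering of `ExteriorTailHolderSpaces`; `gCart`, `βCart`,
  `admForm` — `g(t)`, `β`, and the ADM `4`-metric read in the Cartesian slice coordinates `y = r p`
  of `M = E3 ∖ B̄_{r₀}`; `sphereNormal` (`n_t`), `meanCurv` (`H_{t,r}`, the printed trace formula),
  `sliceK` (`K_t = (2N)⁻¹(∂_t g(t) - ∇β - (∇β)ᵗ)`, `∇` the Levi-Civita connection of `g(t)` via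
  `MetricCoord.chrAt`), `traceSK` (`tr_{S_{t,r}} K_t = tr_{g(t)} K_t - K_t(n_t, n_t)`), `forcing`
  (`Ξ`), `betaPerp` (`β^⊥`), the `γ`-norms, and `X0`, `X1`, `X2` (`𝔛₀, 𝔛₁, 𝔛₂`).
* **Definition 3.6** (p. 21, coefficient class `𝒞𝒮_{-τ}(ℳ)` on exterior tails, `τ ∈ (1/2, 1)`):
  (i) `𝒩_τ(r₁) := ∑_{j=0}^{2} sup_{t > T̲} (‖∂_t^j(N-1)(t)‖_{C^{2+α,1+α/2}_{-τ-j}(M_{r₁,∞})} +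
  ‖∂_t^j(λ-1)(t)‖ + ‖∂_t^j b(t)‖ + ‖∂_t^j β(t)‖ + ‖∂_t^j(r⁻² γ(t) - γ_{S²})‖) < ∞` for every
  `r₁ > r₀`; (ii) constants `δ_*(r₁), ϑ_*(r₁), c_*(r₁) > 0` with `δ_*⁻¹ ≥ λ ≥ δ_*`,
  `ϑ_*⁻¹ ≥ N + |β^T|²_γ ≥ N ≥ ϑ_*`, `c_*⁻¹ ≥ r H_{t,r} ≥ c_*` on `(T̲, ∞) × M_{r₁,∞}`; (iii) for every
  `r₁ > r₀` and `T`, the `𝔛_i` are finite and `∫_{r₁}^∞ 𝔛₀(σ,T)/σ dσ`, `∫_{r₁}^∞ 𝔛₁`, `∫_{r₁}^∞ 𝔛₂`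
  are finite — `ADMTailTuple.IsTailCoeff`.
* **Definition 3.8** (pp. 21–22): `𝒞𝒮♯_{-τ}(ℳ)` = tuples in `𝒞𝒮_{-τ}(ℳ)` with
  `𝒩♯_τ(r₁) := ∑_{k=0}^{3} sup_{t > T̲} (‖∂_t^k(N-1)(t)‖_{C^{2+α,1+α/2,♯}_{-τ-k}(M_{r₁,∞})} + …) < ∞`
  for every `r₁ > r₀` — `ADMTailTuple.IsSharpTailCoeff`; and the geometric normal-shift tail
  `𝔅♯(T; r₁) := sup_{t ≥ T} ‖β^⊥(t, ·)‖_{C^{2+α,1+α/2,♯}_{-τ}(M_{r₁,∞})}` — `ADMTailTuple.normalShiftTail`.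

## Design

* The exterior `ℳ = (T̲, ∞) × (r₀, ∞) × S²` is parametrised by `(t, r, p)`; its slices `M_t` are
  read in the global Cartesian chart `y = r p ∈ E3`, `‖y‖ > r₀`, where a tangent vector `Y` at
  `y` splits as `Y = c p + X`, `c = ⟪p, Y⟫ = dr(Y)`, `X = Π_p Y`, and the angular velocity in the
  unit-sphere variable is `ξ = X / r` (`dy = p dr + r dp`). Hence
  `g(t)(Y, Y') = (λ² + |b|²_γ) c c' + c b(ξ') + c' b(ξ) + γ(ξ, ξ')`, `β(Y) = β_r c + β^T(ξ)`, and a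
  unit-sphere tangent vector `ξ` (e.g. `b^{♯γ}`) is the Cartesian vector `r ξ`.
* `K_t` is computed by the ADM formula `K_t = (2N)⁻¹(∂_t g(t) - 𝓛_{β^♯} g(t))`,
  `𝓛_{β^♯} g = ∇β + (∇β)ᵗ`, `(∇_Y β)(Z) = ∂_Y β(Z) - β(Γ(Y, Z))` [folklore]; the print only names
  `K_t` "the second fundamental form of `M_t`", whose overall sign convention is immaterial here:
  only `|Ξ|`, `|d̸Ξ|_γ`, `|∇̸²Ξ|_γ` enter Defs. 3.6, 3.28.
* `𝓛_{b^♯} γ` on `S²` is computed through the round connection,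
  `(𝓛_V γ)(X, Y) = (∇̸_V γ)(X, Y) + γ(∇̸_X V, Y) + γ(X, ∇̸_Y V)` (any torsion-free connection
  computes a Lie derivative) [folklore]; `∇̸²_γ Ξ = D̸² Ξ - dΞ ∘ C_γ` with `C_γ = ∇^γ - D̸` the
  difference tensor `C_γ(X,Y) = ½ γ⁻¹((∇̸_X γ)(Y,·) + (∇̸_Y γ)(X,·) - (∇̸_· γ)(X,Y))` [folklore].
* `γ`-inverses use the radial completion `γ̂_p = γ_p(Π_p ·, Π_p ·) + ⟪p, ·⟫⟪p, ·⟫` (invertible on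
  `E3` iff `γ_p` is on `p^⊥`; block diagonal, so traces / raised indices of tangential tensors are
  exact); `|ω|²_γ = ω(γ̂⁻¹ ω)`, `|B|²_γ = tr((γ̂⁻¹ B)(γ̂⁻¹ Bᵗ))`.
* All suprema are `ℝ≥0∞`-valued; quantities displaying derivatives are `⊤` off explicit
  differentiability guards (`ForcingRegularAt`, `TDiffOn`), as in `ExteriorTailHolderSpaces`;
  divisions by `N`, `λ`, `H` are Lean divisions (junk at `0`; on the class they are positive by
  (ii)). Integrals `∫_{r₁}^∞` are lower Lebesgue integrals over `Ioi r₁`.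
* NOT here: Defs. 3.28/3.29 (files `ADMTailForcingDecay`, `ADMTailGaugeReducible`), the quasi final
  state hypothesis Def. 4.4 (file `QuasiFinalAnalytic`), Remark 3.7, Lemma 3.3, Remark 3.10.

## References

* [Ellithy2026] A. Ellithy, arXiv:2605.18730 (2026), §3.1, pp. 21–22:, Definition 3.6,
  Remark 3.7, Definition 3.8, Remark 3.9.
* R. Arnowitt, S. Deser, C. W. Misner (1962); ADM decomposition, `K = (2N)⁻¹(∂_t g - 𝓛_β g)`.
  [folklore]
-/

noncomputable section

-- nested operator spaces `E3 →L[ℝ] E3 →L[ℝ] E3 →L[ℝ] ℝ` (as in `CoordCurvature`)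
set_option maxSynthPendingDepth 3

open Set Metric Function MeasureTheory
open scoped ENNReal NNReal Topology RealInnerProductSpace

namespace Literature.Geometry.Lorentzian

/-! ### The raw coefficient tuple `𝒮 = (N, λ, β, b, γ)` -/

/-- **An ADM coefficient tuple `𝒮 = (N, λ, β, b, γ)` on the exterior `ℳ = (T̲, ∞) × (r₀, ∞) × S²`**
(Ellithy 2026, §3.1,, p. 21): raw coefficient functions of `(t, r, p)`, `p ∈ S² ⊂ E3` — the
lapse `N`, the radial (foliation) lapse `λ`, the shift `β = β_r dr + β^T` ("a `1`-form on `ℳ` with no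
`dt`-component": radial component `βr` and sphere-tangent part `βT`), the `1`-form `b` tangent to the
spheres `S_{t,r}`, and the family `γ(t, r)` of metrics on `S²`; sphere-tangent tensors are ambient
(co/bi)linear maps on `E3` (tangentiality is part of `IsWellFormedOn`). No regularity is built in.
[cite: Ellithy2026, §3.1 p. 21] -/
structure ADMTailTuple where
  /-- the lapse `N(t, r, p)` -/
  N : ℝ → ℝ → sphere (0 : E3) 1 → ℝ
  /-- the radial lapse `λ(t, r, p) = |∇^{g(t)} r|⁻¹` -/
  lam : ℝ → ℝ → sphere (0 : E3) 1 → ℝ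
  /-- the `dr`-component `β_r` of the shift `β` -/
  βr : ℝ → ℝ → sphere (0 : E3) 1 → ℝ
  /-- the sphere-tangent part `β^T` of the shift (a covector on `T_p S²`, ambient) -/
  βT : ℝ → ℝ → sphere (0 : E3) 1 → (E3 →L[ℝ] ℝ)
  /-- the `1`-form `b` tangent to the spheres -/
  b : ℝ → ℝ → sphere (0 : E3) 1 → (E3 →L[ℝ] ℝ)
  /-- the metrics `γ(t, r)` on `S²` (a symmetric bilinear form on `T_p S²`, ambient) -/
  γ : ℝ → ℝ → sphere (0 : E3) 1 → (E3 →L[ℝ] E3 →L[ℝ] ℝ)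

namespace ADMTailTuple

variable (S : ADMTailTuple)

/-- **Well-formedness of the tuple on `ℳ_{T̲, r₀}`** (the standing conventions of Ellithy 2026, §3.1,
p. 21: `β^T`, `b` tangent to the spheres, `γ(t,r)` metrics on `S²`): for `t > T̲`, `r > r₀`, the ambient
renderings of `β^T`, `b`, `γ` factor through `Π_p`, and `γ` is symmetric and positive definite on
`T_p S² = p^⊥`. [cite: Ellithy2026, §3.1 p. 21] -/
def IsWellFormedOn (Tlo r₀ : ℝ) : Prop :=
  ∀ (t r : ℝ) (p : sphere (0 : E3) 1), Tlo < t → r₀ < r →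
    S.βT t r p = (S.βT t r p).comp (sphereTanProj (p : E3)) ∧
    S.b t r p = (S.b t r p).comp (sphereTanProj (p : E3)) ∧
    S.γ t r p = (S.γ t r p).bilinearComp (sphereTanProj (p : E3)) (sphereTanProj (p : E3)) ∧
    (∀ X Y : E3, S.γ t r p X Y = S.γ t r p Y X) ∧
    (∀ X : E3, ⟪(p : E3), X⟫ = 0 → X ≠ 0 → 0 < S.γ t r p X X)

/-! ### Angular linear algebra with `γ`: radial completion, raised indices, norms, traces -/

/-- `γ` with both slots projected: `γ_p(Π_p ·, Π_p ·)`. [cite: Ellithy2026, §3.1 p. 21] -/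
def gammaTan (t r : ℝ) (p : sphere (0 : E3) 1) : E3 →L[ℝ] E3 →L[ℝ] ℝ :=
  (S.γ t r p).bilinearComp (sphereTanProj (p : E3)) (sphereTanProj (p : E3))

/-- The radial completion `γ̂_p = γ_p(Π_p ·, Π_p ·) + ⟪p, ·⟫ ⟪p, ·⟫`, a bilinear form on all of `E3`
(invertible iff `γ_p` is nondegenerate on `p^⊥`; used only to invert `γ` on tangential tensors).
[folklore] -/
def gammaHat (t r : ℝ) (p : sphere (0 : E3) 1) : E3 →L[ℝ] E3 →L[ℝ] ℝ :=
  S.gammaTan t r p +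
    (ContinuousLinearMap.mul ℝ ℝ).bilinearComp (innerSL ℝ (p : E3)) (innerSL ℝ (p : E3))

/-- Index raising with `γ`: `ω ↦ ω^{♯γ} ∈ T_p S²` for an angular covector `ω` (through `γ̂⁻¹`,
`ContinuousLinearMap.inverse`, junk `0` if singular). [cite: Ellithy2026, §3.1 p. 21] -/
def gammaSharp (t r : ℝ) (p : sphere (0 : E3) 1) (ω : E3 →L[ℝ] ℝ) : E3 :=
  sphereTanProj (p : E3) ((S.gammaHat t r p).inverse (ω.comp (sphereTanProj (p : E3))))

/-- `|ω|²_γ = ω(ω^{♯γ})` for an angular covector (e.g. `|b|²_γ`, `|β^T|²_γ`, `|d̸Ξ|²_γ`).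
[cite: Ellithy2026, §3.1 p. 21] -/
def gammaNormSq (t r : ℝ) (p : sphere (0 : E3) 1) (ω : E3 →L[ℝ] ℝ) : ℝ :=
  ω (S.gammaSharp t r p ω)

/-- `tr_γ B` for a tangential bilinear form `B`: the trace of `γ̂⁻¹ B` on `E3` (exact by block
diagonality). [cite: Ellithy2026, §3.1 p. 21] -/
def gammaTrace (t r : ℝ) (p : sphere (0 : E3) 1) (B : E3 →L[ℝ] E3 →L[ℝ] ℝ) : ℝ :=
  LinearMap.trace ℝ E3
    (((S.gammaHat t r p).inverse).comp
      (B.bilinearComp (sphereTanProj (p : E3)) (sphereTanProj (p : E3)))).toLinearMap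

/-- `|B|²_γ = γ^{AC} γ^{BD} B_{AB} B_{CD} = tr((γ̂⁻¹ B)(γ̂⁻¹ Bᵗ))` for a tangential bilinear form
(e.g. `|∇̸²_γ Ξ|²_γ`). [cite: Ellithy2026, §3.1 p. 21] -/
def gammaNormSqBilin (t r : ℝ) (p : sphere (0 : E3) 1) (B : E3 →L[ℝ] E3 →L[ℝ] ℝ) : ℝ :=
  let Bt := B.bilinearComp (sphereTanProj (p : E3)) (sphereTanProj (p : E3))
  LinearMap.trace ℝ E3
    ((((S.gammaHat t r p).inverse).comp Bt).comp
      (((S.gammaHat t r p).inverse).comp Bt.flip)).toLinearMap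

/-- `b^{♯γ}(t, r, p) ∈ T_p S²`. [cite: Ellithy2026, §3.1 p. 21] -/
def bSharp (t r : ℝ) (p : sphere (0 : E3) 1) : E3 :=
  S.gammaSharp t r p (S.b t r p)

/-! ### The slice geometry in the Cartesian chart `y = r p` of `M_t` -/

/-- The angular-velocity map at `y`: `Y ↦ ξ = Π_p Y / r` (`r = ‖y‖`, `p = ray y`), identifying the
tangential part of a Cartesian vector with a tangent vector of the UNIT sphere (`dy = p dr + r dp`).
[folklore] -/
def angVel (y : E3) : E3 →L[ℝ] E3 :=
  ‖y‖⁻¹ • sphereTanProj (raySphere y : E3)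

/-- **The slice metric `g(t)` in Cartesian coordinates**:
`g(t)_y(Y, Y') = (λ² + |b|²_γ) c c' + c b(ξ') + c' b(ξ) + γ(ξ, ξ')`, `c = ⟪p, Y⟫`, `ξ = Π_p Y / r` —
the print's `g(t) = (λ² + |b|²_γ) dr² + 2 b ⊙ dr + γ` (Ellithy 2026,, p. 21) read at `y = r p`.
[cite: Ellithy2026, §3.1 p. 21] -/
def gCart (t : ℝ) (y : E3) : E3 →L[ℝ] E3 →L[ℝ] ℝ :=
  let r := ‖y‖
  let p := raySphere y
  let dr : E3 →L[ℝ] ℝ := innerSL ℝ (p : E3)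
  let bξ : E3 →L[ℝ] ℝ := (S.b t r p).comp (angVel y)
  (S.lam t r p ^ 2 + S.gammaNormSq t r p (S.b t r p)) •
      (ContinuousLinearMap.mul ℝ ℝ).bilinearComp dr dr
    + (ContinuousLinearMap.mul ℝ ℝ).bilinearComp dr bξ
    + (ContinuousLinearMap.mul ℝ ℝ).bilinearComp bξ dr
    + (S.γ t r p).bilinearComp (angVel y) (angVel y)

/-- **The shift `β` in Cartesian coordinates**: `β_y(Y) = β_r c + β^T(ξ)` (no `dt`-component).
[cite: Ellithy2026, §3.1 p. 21] -/
def βCart (t : ℝ) (y : E3) : E3 →L[ℝ] ℝ :=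
  S.βr t ‖y‖ (raySphere y) • innerSL ℝ (raySphere y : E3) + (S.βT t ‖y‖ (raySphere y)).comp (angVel y)

/-- `|β|²_{g(t)} = β(g(t)⁻¹ β)` at `y`. [cite: Ellithy2026, §3.1 p. 21] -/
def betaNormSq (t : ℝ) (y : E3) : ℝ :=
  S.βCart t y ((S.gCart t y).inverse (S.βCart t y))

/-- **The ADM `4`-metric of the tuple** at `(t, y)`, a bilinear form on `ℝ × E3` (`(a, Y)` = `a ∂_t + Y`):
`-(N² - |β|²_{g(t)}) a a' + a β(Y') + a' β(Y) + g(t)(Y, Y')` — the print's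
`g = -(N² - |β|²_{g(t)}) dt² + 2 β ⊙ dt + g(t)` (Ellithy 2026,, p. 21).
[cite: Ellithy2026, §3.1 p. 21] -/
def admForm (t : ℝ) (y : E3) : (ℝ × E3) →L[ℝ] (ℝ × E3) →L[ℝ] ℝ :=
  let dt : (ℝ × E3) →L[ℝ] ℝ := ContinuousLinearMap.fst ℝ ℝ E3
  let dy : (ℝ × E3) →L[ℝ] E3 := ContinuousLinearMap.snd ℝ ℝ E3
  (-(S.N t ‖y‖ (raySphere y) ^ 2 - S.betaNormSq t y)) •
      (ContinuousLinearMap.mul ℝ ℝ).bilinearComp dt dt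
    + (ContinuousLinearMap.mul ℝ ℝ).bilinearComp dt ((S.βCart t y).comp dy)
    + (ContinuousLinearMap.mul ℝ ℝ).bilinearComp ((S.βCart t y).comp dy) dt
    + (S.gCart t y).bilinearComp dy dy

/-- **The outward unit normal `n_t = λ⁻¹(∂_r - b^{♯γ})` to `S_{t,r} ⊂ (M_t, g(t))`** (Ellithy 2026,
§3.1, p. 21) as a Cartesian vector at `y = r p`: `∂_r = p` and the unit-sphere vector `b^{♯γ}` is the
Cartesian vector `r b^{♯γ}`. [cite: Ellithy2026, §3.1 p. 21] -/
def sphereNormal (t : ℝ) (y : E3) : E3 :=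
  (S.lam t ‖y‖ (raySphere y))⁻¹ • ((raySphere y : E3) - ‖y‖ • S.bSharp t ‖y‖ (raySphere y))

/-- `∂_r γ(t, r)` at `p` (radial derivative of the family of sphere metrics; `deriv`, junk `0`).
[cite: Ellithy2026, §3.1 p. 21] -/
def dGammaDr (t r : ℝ) (p : sphere (0 : E3) 1) : E3 →L[ℝ] E3 →L[ℝ] ℝ :=
  deriv (fun ρ ↦ S.γ t ρ p) r

/-- **`𝓛_{b^{♯γ}} γ(t, r)` on `S²`** at `p`, through the round connection `D̸`:
`(𝓛_V γ)(X, Y) = (∇̸_V γ)(X, Y) + γ(∇̸_X V, Y) + γ(X, ∇̸_Y V)`, `V = b^{♯γ}` (a Lie derivative may be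
computed with any torsion-free connection). [cite: Ellithy2026, §3.1 p. 21] -/
def lieBSharpGamma (t r : ℝ) (p : sphere (0 : E3) 1) : E3 →L[ℝ] E3 →L[ℝ] ℝ :=
  let Pp : E3 →L[ℝ] E3 := sphereTanProj (p : E3)
  let DV : E3 →L[ℝ] E3 :=
    Pp.comp (continuousMultilinearCurryFin1 ℝ E3 E3 (sphereCovDeriv 1 (fun q ↦ S.bSharp t r q) p))
  let Dγ : E3 →L[ℝ] E3 →L[ℝ] E3 →L[ℝ] ℝ :=
    continuousMultilinearCurryFin1 ℝ E3 (E3 →L[ℝ] E3 →L[ℝ] ℝ)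
      (sphereCovDeriv 1 (fun q ↦ S.gammaTan t r q) p)
  (Dγ (S.bSharp t r p)).bilinearComp Pp Pp
    + (S.gammaTan t r p).bilinearComp DV (ContinuousLinearMap.id ℝ E3)
    + (S.gammaTan t r p).bilinearComp (ContinuousLinearMap.id ℝ E3) DV

/-- **The mean curvature `H_{t,r}` of `S_{t,r} ⊂ (M_t, g(t))`** by the printed formula
`H_{t,r} = (2λ)⁻¹ tr_{γ(t,r)}(∂_r γ(t,r) - 𝓛_{b^{♯γ}} γ(t,r))` (Ellithy 2026,, p. 21).
[cite: Ellithy2026, §3.1 p. 21] -/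
def meanCurv (t r : ℝ) (p : sphere (0 : E3) 1) : ℝ :=
  (2 * S.lam t r p)⁻¹ * S.gammaTrace t r p (S.dGammaDr t r p - S.lieBSharpGamma t r p)

/-- **The second fundamental form `K_t` of `M_t ↪ (ℳ, g)`** in Cartesian coordinates, by the ADM
formula `K_t(Y, Z) = (2N)⁻¹ (∂_t g(t)(Y,Z) - (∇_Y β)(Z) - (∇_Z β)(Y))`,
`(∇_Y β)(Z) = ∂_Y β(Z) - β(Γ(Y,Z))`, `Γ` the Christoffel map of `g(t)` (`MetricCoord.chrAt`); the
print (p. 21) names `K_t` without displaying a sign convention, which is immaterial downstream.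
[cite: Ellithy2026, §3.1 p. 21] -/
def sliceK (t : ℝ) (y : E3) : E3 →L[ℝ] E3 →L[ℝ] ℝ :=
  let dtg : E3 →L[ℝ] E3 →L[ℝ] ℝ := deriv (fun s ↦ S.gCart s y) t
  let Dβ : E3 →L[ℝ] E3 →L[ℝ] ℝ := fderiv ℝ (fun z ↦ S.βCart t z) y
  let βΓ : E3 →L[ℝ] E3 →L[ℝ] ℝ :=
    ((ContinuousLinearMap.compL ℝ E3 E3 ℝ) (S.βCart t y)).comp (MetricCoord.chrAt (S.gCart t) y)
  let covβ : E3 →L[ℝ] E3 →L[ℝ] ℝ := Dβ - βΓ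
  (2 * S.N t ‖y‖ (raySphere y))⁻¹ • (dtg - covβ - covβ.flip)

/-- **`tr_{S_{t,r}} K_t = tr_{g(t)} K_t - K_t(n_t, n_t)`** at `y = r p` (trace of `K_t` restricted to
the sphere through `y`, w.r.t. the induced metric). [cite: Ellithy2026, §3.1 p. 21] -/
def traceSK (t : ℝ) (y : E3) : ℝ :=
  LinearMap.trace ℝ E3 (((S.gCart t y).inverse).comp (S.sliceK t y)).toLinearMap
    - S.sliceK t y (S.sphereNormal t y) (S.sphereNormal t y)

/-- **The background forcing `Ξ(t, r, p) := (λ/N) · tr_{S_{t,r}} K_t / H_{t,r}`** (Ellithy 2026,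
§3.1, p. 21; "whenever this quantity is finite" — Lean division, junk where `N H = 0`).
[cite: Ellithy2026, §3.1 p. 21] -/
def forcing (t r : ℝ) (p : sphere (0 : E3) 1) : ℝ :=
  S.lam t r p / S.N t r p * S.traceSK t (r • (p : E3)) / S.meanCurv t r p

/-- **The geometric normal component of the shift `β^⊥ := β(n_t)`** (Ellithy 2026, §3.1, p. 21),
as a function on the tail. [cite: Ellithy2026, §3.1 p. 21] -/
def betaPerp (t r : ℝ) (p : sphere (0 : E3) 1) : ℝ :=
  S.βCart t (r • (p : E3)) (S.sphereNormal t (r • (p : E3)))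

/-- `d̸Ξ(t, r, ·)` at `p` as an angular covector. [cite: Ellithy2026, §3.1 p. 21] -/
def dForcing (t r : ℝ) (p : sphere (0 : E3) 1) : E3 →L[ℝ] ℝ :=
  continuousMultilinearCurryFin1 ℝ E3 ℝ (sphereCovDeriv 1 (fun q ↦ S.forcing t r q) p)

/-- The difference tensor `C_γ = ∇^γ - D̸` of the Levi-Civita connection of `γ(t,r)` and the round
one: `C_γ(X, Y) = ½ γ̂⁻¹ (T(X,Y,·) + T(Y,·,X) - T(·,X,Y))`, `T(X,Y,Z) = (∇̸_X γ)(Y,Z)` (Koszul form of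
`∇̸γ`, `MetricCoord.koszulOp`). [folklore] -/
def gammaConnDiff (t r : ℝ) (p : sphere (0 : E3) 1) : E3 →L[ℝ] E3 →L[ℝ] E3 :=
  let Pp : E3 →L[ℝ] E3 := sphereTanProj (p : E3)
  let Dγ : E3 →L[ℝ] E3 →L[ℝ] E3 →L[ℝ] ℝ :=
    continuousMultilinearCurryFin1 ℝ E3 (E3 →L[ℝ] E3 →L[ℝ] ℝ)
      (sphereCovDeriv 1 (fun q ↦ S.gammaTan t r q) p)
  -- project the two value slots: `B ↦ B(Π ·, Π ·)` as a continuous linear operator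
  let projBilin : (E3 →L[ℝ] E3 →L[ℝ] ℝ) →L[ℝ] (E3 →L[ℝ] E3 →L[ℝ] ℝ) :=
    (ContinuousLinearMap.compL ℝ E3 (E3 →L[ℝ] ℝ) (E3 →L[ℝ] ℝ)
        ((ContinuousLinearMap.compL ℝ E3 E3 ℝ).flip Pp)).comp
      ((ContinuousLinearMap.compL ℝ E3 E3 (E3 →L[ℝ] ℝ)).flip Pp)
  let T : E3 →L[ℝ] E3 →L[ℝ] E3 →L[ℝ] ℝ := projBilin.comp Dγ
  (2⁻¹ : ℝ) • ((ContinuousLinearMap.compL ℝ E3 (E3 →L[ℝ] ℝ) E3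
      (Pp.comp (S.gammaHat t r p).inverse)).comp (MetricCoord.koszulOp T))

/-- **`∇̸²_γ Ξ(t, r, ·)` at `p`**, the covariant Hessian of `Ξ` for the metric `γ(t, r)`:
`D̸²Ξ(X, Y) - d̸Ξ(C_γ(X, Y))`. [cite: Ellithy2026, §3.1 p. 21] -/
def hessForcing (t r : ℝ) (p : sphere (0 : E3) 1) : E3 →L[ℝ] E3 →L[ℝ] ℝ :=
  let D2 : E3 →L[ℝ] E3 →L[ℝ] ℝ :=
    ((continuousMultilinearCurryFin1 ℝ E3 ℝ).toContinuousLinearEquiv : _ →L[ℝ] _).comp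
      (sphereCovDeriv 2 (fun q ↦ S.forcing t r q) p).curryLeft
  D2 - ((ContinuousLinearMap.compL ℝ E3 E3 ℝ) (S.dForcing t r p)).comp (S.gammaConnDiff t r p)

/-! ### The tail-size functions `𝔛₀, 𝔛₁, 𝔛₂` (§3.1, p. 21) -/

/-- **Regularity guard for the forcing at `(t, r, p)` to order `k`**: the derivatives entering `K_t`
(`∂_t g(t)`, `∂ β`, `∂ g(t)` at `y = r p`) and `H_{t,r}` (`∂_r γ`, `∇̸γ`, `∇̸ b^{♯γ}`) exist, and
`Ξ(t, r, ·)` is `k` times angularly differentiable at `p` (for `𝔛₁`: `k = 1`, for `𝔛₂`: `k = 2`).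
[cite: Ellithy2026, §3.1 p. 21] -/
def ForcingRegularAt (k : ℕ) (t r : ℝ) (p : sphere (0 : E3) 1) : Prop :=
  DifferentiableAt ℝ (fun y ↦ S.gCart t y) (r • (p : E3)) ∧
  DifferentiableAt ℝ (fun y ↦ S.βCart t y) (r • (p : E3)) ∧
  DifferentiableAt ℝ (fun s ↦ S.gCart s (r • (p : E3))) t ∧
  DifferentiableAt ℝ (fun ρ ↦ S.γ t ρ p) r ∧
  SphereDiffAt 1 (fun q ↦ S.gammaTan t r q) p ∧
  SphereDiffAt 1 (fun q ↦ S.bSharp t r q) p ∧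
  SphereDiffAt k (fun q ↦ S.forcing t r q) p

open scoped Classical in
/-- **`𝔛₀(r, T) := r sup_{t ≥ T, p ∈ S²} |Ξ(t, r, p)|`** (Ellithy 2026,, p. 21; `sup_{t ≥ T}`
read as `t ≥ T, t > T̲`), in `[0, ∞]`, `⊤` off the guard `ForcingRegularAt 0` on the slab.
[cite: Ellithy2026, §3.1 p. 21] -/
def X0 (Tlo r T : ℝ) : ℝ≥0∞ :=
  if ∀ t, T ≤ t → Tlo < t → ∀ p, S.ForcingRegularAt 0 t r p then
    ENNReal.ofReal r * ⨆ (t : ℝ) (_ : T ≤ t) (_ : Tlo < t) (p : sphere (0 : E3) 1), ‖S.forcing t r p‖ₑ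
  else ⊤

open scoped Classical in
/-- **`𝔛₁(r, T) := r sup_{t ≥ T, p ∈ S²} |d̸_γ Ξ(t, r, p)|_{γ(t,r)}`** (Ellithy 2026,, p. 21),
`⊤` off the guard `ForcingRegularAt 1`. [cite: Ellithy2026, §3.1 p. 21] -/
def X1 (Tlo r T : ℝ) : ℝ≥0∞ :=
  if ∀ t, T ≤ t → Tlo < t → ∀ p, S.ForcingRegularAt 1 t r p then
    ENNReal.ofReal r * ⨆ (t : ℝ) (_ : T ≤ t) (_ : Tlo < t) (p : sphere (0 : E3) 1),
      ENNReal.ofReal (Real.sqrt (S.gammaNormSq t r p (S.dForcing t r p)))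
  else ⊤

open scoped Classical in
/-- **`𝔛₂(r, T) := r² sup_{t ≥ T, p ∈ S²} |∇̸²_γ Ξ(t, r, p)|_{γ(t,r)}`** (Ellithy 2026,, p. 21),
`⊤` off the guard `ForcingRegularAt 2`. [cite: Ellithy2026, §3.1 p. 21] -/
def X2 (Tlo r T : ℝ) : ℝ≥0∞ :=
  if ∀ t, T ≤ t → Tlo < t → ∀ p, S.ForcingRegularAt 2 t r p then
    ENNReal.ofReal (r ^ 2) * ⨆ (t : ℝ) (_ : T ≤ t) (_ : Tlo < t) (p : sphere (0 : E3) 1),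
      ENNReal.ofReal (Real.sqrt (S.gammaNormSqBilin t r p (S.hessForcing t r p)))
  else ⊤

/-! ### Definition 3.6: the coefficient class `𝒞𝒮_{-τ}(ℳ)` -/

section Classes

variable {W : Type*} [NormedAddCommGroup W] [NormedSpace ℝ W]

/-- `∂_t^j f(t)` as a function on the tail (`iteratedDeriv` in `t` at fixed `(r, p)`, junk where not
differentiable). [cite: Ellithy2026, Def. 3.6 p. 21] -/
def tDeriv (j : ℕ) (f : ℝ → ℝ → sphere (0 : E3) 1 → W) (t : ℝ) : ℝ → sphere (0 : E3) 1 → W :=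
  fun r p ↦ iteratedDeriv j (fun s ↦ f s r p) t

/-- Guard: `f(·, r, p)` is `j` times differentiable in `t` on `(T̲, ∞)` for `r > r₁` (all lower
iterated `t`-derivatives differentiable). [cite: Ellithy2026, Def. 3.6 p. 21] -/
def TDiffOn (j : ℕ) (Tlo r₁ : ℝ) (f : ℝ → ℝ → sphere (0 : E3) 1 → W) : Prop :=
  ∀ t, Tlo < t → ∀ r, r₁ < r → ∀ (p : sphere (0 : E3) 1), ∀ m < j,
    DifferentiableAt ℝ (iteratedDeriv m (fun s ↦ f s r p)) t

open scoped Classical in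
/-- **`sup_{t > T̲} ‖∂_t^j f(t)‖_{C^{2+α,1+α/2}_{-σ}(M_{r₁,∞})}`**, one summand of `𝒩_τ(r₁)`
(Ellithy 2026, Def. 3.6, p. 21), `⊤` off the `t`-differentiability guard.
[cite: Ellithy2026, Def. 3.6 p. 21] -/
def supTailNorm (α σ : ℝ) (j : ℕ) (Tlo r₁ : ℝ) (f : ℝ → ℝ → sphere (0 : E3) 1 → W) : ℝ≥0∞ :=
  if TDiffOn j Tlo r₁ f then ⨆ (t : ℝ) (_ : Tlo < t), ctWeightedNorm α σ (Ioi r₁) (tDeriv j f t)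
  else ⊤

open scoped Classical in
/-- **`sup_{t > T̲} ‖∂_t^k f(t)‖_{C^{2+α,1+α/2,♯}_{-σ}(M_{r₁,∞})}`**, one summand of `𝒩♯_τ(r₁)`
(Ellithy 2026, Def. 3.8, p. 22), `⊤` off the `t`-differentiability guard.
[cite: Ellithy2026, Def. 3.8 p. 22] -/
def supSharpTailNorm (α σ : ℝ) (k : ℕ) (Tlo r₁ : ℝ) (f : ℝ → ℝ → sphere (0 : E3) 1 → W) : ℝ≥0∞ :=
  if TDiffOn k Tlo r₁ f then
    ⨆ (t : ℝ) (_ : Tlo < t), ctSharpWeightedNorm α σ (Ioi r₁) (tDeriv k f t)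
  else ⊤

end Classes

/-- `N - 1` as a function of `(t, r, p)`. [cite: Ellithy2026, Def. 3.6 p. 21] -/
def lapseDev : ℝ → ℝ → sphere (0 : E3) 1 → ℝ := fun t r p ↦ S.N t r p - 1

/-- `λ - 1` as a function of `(t, r, p)`. [cite: Ellithy2026, Def. 3.6 p. 21] -/
def lamDev : ℝ → ℝ → sphere (0 : E3) 1 → ℝ := fun t r p ↦ S.lam t r p - 1

/-- The shift `β = (β_r, β^T)` as one `ℝ × (E3 →L ℝ)`-valued function (componentwise norms).
[cite: Ellithy2026, Def. 3.6 p. 21] -/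
def shift : ℝ → ℝ → sphere (0 : E3) 1 → ℝ × (E3 →L[ℝ] ℝ) := fun t r p ↦ (S.βr t r p, S.βT t r p)

/-- `r⁻² γ(t, r) - γ_{S²}` at `p`, the round metric being `⟪Π_p ·, Π_p ·⟫` in the ambient rendering.
[cite: Ellithy2026, Def. 3.6 p. 21] -/
def gammaDev : ℝ → ℝ → sphere (0 : E3) 1 → (E3 →L[ℝ] E3 →L[ℝ] ℝ) := fun t r p ↦
  (r ^ 2)⁻¹ • S.gammaTan t r p -
    (innerSL ℝ : E3 →L[ℝ] E3 →L[ℝ] ℝ).bilinearComp (sphereTanProj (p : E3)) (sphereTanProj (p : E3))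

/-- **`𝒩_τ(r₁)`** (Ellithy 2026, Def. 3.6 (i),, p. 21):
`∑_{j=0}^{2} sup_{t > T̲} (‖∂_t^j(N-1)(t)‖_{C^{2+α,1+α/2}_{-τ-j}(M_{r₁,∞})} + ‖∂_t^j(λ-1)(t)‖_{…}
+ ‖∂_t^j b(t)‖_{…} + ‖∂_t^j β(t)‖_{…} + ‖∂_t^j(r⁻²γ(t) - γ_{S²})‖_{…})`, in `[0, ∞]`.
[cite: Ellithy2026, Def. 3.6 p. 21] -/
def tailNormN (α τ Tlo r₁ : ℝ) : ℝ≥0∞ :=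
  ∑ j ∈ Finset.range 3,
    (supTailNorm α (τ + j) j Tlo r₁ S.lapseDev + supTailNorm α (τ + j) j Tlo r₁ S.lamDev
      + supTailNorm α (τ + j) j Tlo r₁ S.b + supTailNorm α (τ + j) j Tlo r₁ S.shift
      + supTailNorm α (τ + j) j Tlo r₁ S.gammaDev)

/-- **Definition 3.6 (ii), tail nondegeneracy and mean-curvature bounds** on the fixed tail
`r > r₁`: positive constants `δ_*, ϑ_*, c_*` with `δ_*⁻¹ ≥ λ ≥ δ_*`,
`ϑ_*⁻¹ ≥ N + |β^T|²_γ ≥ N ≥ ϑ_*`, `c_*⁻¹ ≥ r H_{t,r} ≥ c_*` on `(T̲, ∞) × M_{r₁,∞}` (Ellithy 2026,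
Def. 3.6 (ii), p. 21). [cite: Ellithy2026, Def. 3.6 p. 21] -/
def IsTailNondegenerate (Tlo r₁ : ℝ) : Prop :=
  ∃ δ ϑ c : ℝ, 0 < δ ∧ 0 < ϑ ∧ 0 < c ∧
    ∀ (t r : ℝ) (p : sphere (0 : E3) 1), Tlo < t → r₁ < r →
      δ⁻¹ ≥ S.lam t r p ∧ S.lam t r p ≥ δ ∧
      ϑ⁻¹ ≥ S.N t r p + S.gammaNormSq t r p (S.βT t r p) ∧
      S.N t r p + S.gammaNormSq t r p (S.βT t r p) ≥ S.N t r p ∧ S.N t r p ≥ ϑ ∧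
      c⁻¹ ≥ r * S.meanCurv t r p ∧ r * S.meanCurv t r p ≥ c

/-- **Definition 3.6 (iii), finite forcing tails** on the fixed tail `r > r₁` at the time `T`: the
tail-size functions are finite and `∫_{r₁}^∞ 𝔛₀(σ,T)/σ dσ < ∞`, `∫_{r₁}^∞ 𝔛₁(σ,T) dσ < ∞`,
`∫_{r₁}^∞ 𝔛₂(σ,T) dσ < ∞` (Ellithy 2026,, p. 21; lower Lebesgue integrals over `Ioi r₁`).
[cite: Ellithy2026, Def. 3.6 p. 21] -/
def HasFiniteForcingTail (Tlo r₁ T : ℝ) : Prop :=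
  (∀ σ, r₁ < σ → S.X0 Tlo σ T < ⊤ ∧ S.X1 Tlo σ T < ⊤ ∧ S.X2 Tlo σ T < ⊤) ∧
  (∫⁻ σ in Ioi r₁, S.X0 Tlo σ T / ENNReal.ofReal σ) < ⊤ ∧
  (∫⁻ σ in Ioi r₁, S.X1 Tlo σ T) < ⊤ ∧
  (∫⁻ σ in Ioi r₁, S.X2 Tlo σ T) < ⊤

/-- **Definition 3.6 — the coefficient class on exterior tails, `𝒮 ∈ 𝒞𝒮_{-τ}(ℳ)`**,
`ℳ = (T̲, ∞) × (r₀, ∞) × S²`, Hölder exponent `α`, order `τ` (print: `τ ∈ (1/2, 1)` fixed; here a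
parameter): the tuple is well formed on `ℳ` and, for every `r₁ > r₀`, (i) `𝒩_τ(r₁) < ∞`
("asymptotic flatness with two time derivatives on every fixed tail"), (ii) tail nondegeneracy and
mean-curvature bounds, (iii) finite forcing tails for every `T ∈ ℝ` (Ellithy 2026, Def. 3.6, p. 21:
"`𝒞𝒮_{-τ}(ℳ)` is controlled by a family of tail norms, one for each `r₁ > r₀`").
[cite: Ellithy2026, Def. 3.6 p. 21] -/
def IsTailCoeff (α τ Tlo r₀ : ℝ) : Prop :=
  S.IsWellFormedOn Tlo r₀ ∧
  ∀ r₁, r₀ < r₁ →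
    S.tailNormN α τ Tlo r₁ < ⊤ ∧ S.IsTailNondegenerate Tlo r₁ ∧ ∀ T : ℝ, S.HasFiniteForcingTail Tlo r₁ T

/-! ### Definition 3.8: the strengthened class `𝒞𝒮♯_{-τ}(ℳ)` and the normal-shift tail `𝔅♯` -/

/-- **`𝒩♯_τ(r₁)`** (Ellithy 2026, Def. 3.8,, p. 22):
`∑_{k=0}^{3} sup_{t > T̲} (‖∂_t^k(N-1)(t)‖_{C^{2+α,1+α/2,♯}_{-τ-k}(M_{r₁,∞})} + ‖∂_t^k(λ-1)(t)‖_{…}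
+ ‖∂_t^k b(t)‖_{…} + ‖∂_t^k β(t)‖_{…} + ‖∂_t^k(r⁻²γ(t) - γ_{S²})‖_{…})`, in `[0, ∞]`.
[cite: Ellithy2026, Def. 3.8 p. 22] -/
def sharpTailNormN (α τ Tlo r₁ : ℝ) : ℝ≥0∞ :=
  ∑ k ∈ Finset.range 4,
    (supSharpTailNorm α (τ + k) k Tlo r₁ S.lapseDev + supSharpTailNorm α (τ + k) k Tlo r₁ S.lamDev
      + supSharpTailNorm α (τ + k) k Tlo r₁ S.b + supSharpTailNorm α (τ + k) k Tlo r₁ S.shift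
      + supSharpTailNorm α (τ + k) k Tlo r₁ S.gammaDev)

/-- **Definition 3.8 — the strengthened tail coefficient space, `𝒮 ∈ 𝒞𝒮♯_{-τ}(ℳ)`**: tuples in
`𝒞𝒮_{-τ}(ℳ)` with `𝒩♯_τ(r₁) < ∞` for every `r₁ > r₀` (Ellithy 2026, Def. 3.8, pp. 21–22; Remark 3.9:
"the strengthened tail regularity needed for the coordinate changes … to pass from a general ADM chart
to the good gauge `b = 0`, `β_r = 0`"). [cite: Ellithy2026, Def. 3.8 p. 22] -/
def IsSharpTailCoeff (α τ Tlo r₀ : ℝ) : Prop :=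
  S.IsTailCoeff α τ Tlo r₀ ∧ ∀ r₁, r₀ < r₁ → S.sharpTailNormN α τ Tlo r₁ < ⊤

/-- **The geometric normal-shift tail `𝔅♯(T; r₁) := sup_{t ≥ T} ‖β^⊥(t, ·)‖_{C^{2+α,1+α/2,♯}_{-τ}(M_{r₁,∞})}`**
(Ellithy 2026, Def. 3.8,, p. 22; `t ≥ T, t > T̲`), in `[0, ∞]`.
[cite: Ellithy2026, Def. 3.8 p. 22] -/
def normalShiftTail (α τ Tlo r₁ T : ℝ) : ℝ≥0∞ :=
  ⨆ (t : ℝ) (_ : T ≤ t) (_ : Tlo < t), ctSharpWeightedNorm α τ (Ioi r₁) (S.betaPerp t)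

/-- The strengthened class refines the class of Def. 3.6 (by definition). [cite: Ellithy2026, Def. 3.8 p. 22] -/
theorem IsSharpTailCoeff.isTailCoeff {S : ADMTailTuple} {α τ Tlo r₀ : ℝ}
    (h : S.IsSharpTailCoeff α τ Tlo r₀) : S.IsTailCoeff α τ Tlo r₀ := h.1

/-- A tuple of the class is well formed on `ℳ`. [cite: Ellithy2026, Def. 3.6 p. 21] -/
theorem IsTailCoeff.isWellFormedOn {S : ADMTailTuple} {α τ Tlo r₀ : ℝ}
    (h : S.IsTailCoeff α τ Tlo r₀) : S.IsWellFormedOn Tlo r₀ := h.1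

/-- The fixed-tail conditions of Def. 3.6 for a tuple of the class. [cite: Ellithy2026, Def. 3.6 p. 21] -/
theorem IsTailCoeff.tail {S : ADMTailTuple} {α τ Tlo r₀ : ℝ} (h : S.IsTailCoeff α τ Tlo r₀)
    {r₁ : ℝ} (hr : r₀ < r₁) :
    S.tailNormN α τ Tlo r₁ < ⊤ ∧ S.IsTailNondegenerate Tlo r₁ ∧
      ∀ T : ℝ, S.HasFiniteForcingTail Tlo r₁ T := h.2 r₁ hr

end ADMTailTuple

end Literature.Geometry.Lorentzian

end
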